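import Literature.Topology.FourManifolds.StraightLineAmbientIsotopySupport
import Mathlib.Analysis.ODE.Gronwall
import HarnessLib

/-!
# Isotopy extension for straight-line isotopies, relative to a hyperplane and its half-spaces

Topic `Literature/Topology/FourManifolds` (differential topology in a finite-dimensional real
normed space `E`).  Sibling of `StraightLineAmbientIsotopySupport.lean`, which proves Hirsch's
isotopy extension theorem (*Differential Topology* (1976), Ch. 8 §1, Thms. 1.3–1.4) for the
straight-line isotopies `h_t = id + t (P - id)` near a compact set `Z` on which `P = id`: an
ambient isotopy `F` of `E`, the flow of a compactly supported time-dependent vector field, with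
`F₁ = P` near `Z` and all stages the identity off a prescribed neighbourhood `W'` of `Z`.

Here a hyperplane `{ℓ = 0}` (`ℓ : E →L[ℝ] ℝ`) is added to the picture: **if `P` maps the points
of `W ∩ {ℓ = 0}` into `{ℓ = 0}`, then the ambient isotopy can be chosen to preserve the
hyperplane `{ℓ = 0}` and each of the two open half-spaces `{ℓ > 0}`, `{ℓ < 0}` at all times**
(`exists_ambientIsotopy_of_straightLine_halfSpace`).  Restricted to the closed half-space
`{ℓ ≥ 0}` this is the isotopy extension theorem for straight-line isotopies *in a manifold with
boundary*, the moving compact set being allowed to meet the boundary (as the attaching sphere of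
a handle does): Hirsch, Ch. 8 §1, Thm. 1.3 with the remark of §8.1 that diffeotopies of `∂M`
and vector fields tangent to `∂M` generate diffeotopies of `M`; Kosinski, *Differential
Manifolds* (1993), II (5.2) and the use made of it for tubular neighbourhoods of submanifolds of
the boundary, III §4 (half-tubes) / VI §5.  It is the ODE input of the uniqueness of the tube
germ of a handle attaching map (`PresentationHandlebodyFiveProofs.lean`, roadmap; the 4-d seat's
hypotheses TUB∂/COLLAR of `Geometry/Symplectic/TwoHandleIsotopyReduction.lean`).

Everything here is proved; no definitions other than proof-local ones, no named facts.

## The argument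

The generating field of `StraightLineAmbientIsotopySupport.lean` is
`X(t, y) = ρ(t, y) · (P y' - y')` where `y = h_t(y')` (the track `(t, y') ↦ (t, h_t y')` being
a diffeomorphism near `[0, 1] × Z`).  If `ℓ y = 0` forces `ℓ y' = 0`, then `P y' ∈ {ℓ = 0}` and
`X(t, y)` is tangent to the hyperplane.  That implication holds on the open set
`G₂ = {ℓ(y') ℓ(h_t y') > 0} ∪ C`, where `C` consists of the pairs `(t, y')` along whose
segment from the foot `π y' = y' - ℓ(y') ν` (`ℓ ν = 1`) to `y'` the normal derivative
`Λ(t, ·) = (1 - t) + t ℓ(DP(·) ν)` of `ℓ ∘ h_t` is positive (mean value theorem); `G₂` contains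
`[0, 1] × Z` because at a point `z ∈ Z ∩ {ℓ = 0}` the injectivity of all `id + t (DP(z) - id)`
forces `ℓ(DP(z) ν) > 0` (`pos_normal_of_slDeriv_injective`), and we simply add `G₂` to the open
sets of the tube-lemma step of the original proof.  A compactly supported field tangent to
`{ℓ = 0}` has a flow preserving `{ℓ = 0}` (Grönwall along `ℓ`, `apply_tdFlow_eq_zero_of_tangent`)
and hence each open half-space (intermediate value theorem, `apply_tdFlow_pos_of_tangent`).

## References

* M. W. Hirsch, *Differential Topology*, GTM 33, Springer (1976), Ch. 8 §1, Thms. 1.1–1.4.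
  [HirschDT1976]
* A. A. Kosinski, *Differential Manifolds*, Academic Press (1993), II (5.2); III (3.5), §4;
  VI §5. [Kosinski1993]
-/

noncomputable section

open Set Metric Filter Topology Function

open scoped ContDiff NNReal Manifold

namespace Literature.Topology.FourManifolds

universe u

/-! ### Flows of fields tangent to a hyperplane -/

section HyperplaneInvariance

variable {E : Type u} [NormedAddCommGroup E] [NormedSpace ℝ E] [CompleteSpace E]
  {X : ℝ × E → E} (hX : ContDiff ℝ ∞ X) (hsupp : HasCompactSupport X) (ℓ : E →L[ℝ] ℝ)

/-- **The flow of a compactly supported field tangent to the hyperplane `{ℓ = 0}` preserves the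
hyperplane** (forward and backward in time).  Grönwall's inequality for `u(t) = ℓ(γ(t))` along a
trajectory `γ`: `|u'| = |ℓ X(t, γ) - ℓ X(t, γ - u ν)| ≤ C |u|`.
[cite: HirschDT1976, Ch. 8 §1, Thm. 1.1] -/
theorem apply_tdFlow_eq_zero_of_tangent (htan : ∀ t y, ℓ y = 0 → ℓ (X (t, y)) = 0) {x : E}
    (hx : ℓ x = 0) (t₀ t : ℝ) :
    ℓ (Literature.Analysis.ODE.tdFlow hX hsupp (by simp) t₀ t x) = 0 := by
  by_cases hℓ : ℓ = 0
  · simp [hℓ]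
  -- a normal vector `ν` with `ℓ ν = 1`
  obtain ⟨v, hv⟩ : ∃ v : E, ℓ v ≠ 0 := by
    by_contra h
    push Not at h
    exact hℓ (ContinuousLinearMap.ext fun v => by simpa using h v)
  set ν : E := (ℓ v)⁻¹ • v with hν
  have hℓν : ℓ ν = 1 := by rw [hν, map_smul, smul_eq_mul, inv_mul_cancel₀ hv]
  -- a Lipschitz constant of the field
  obtain ⟨C, hC⟩ := hX.lipschitzWith_of_hasCompactSupport hsupp (by simp)
  set γ : ℝ → E := fun s => Literature.Analysis.ODE.tdFlow hX hsupp (by simp) t₀ s x with hγ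
  set u : ℝ → ℝ := fun s => ℓ (γ s) with hu
  have hγd : ∀ s, HasDerivAt γ (X (s, γ s)) s := fun s =>
    Literature.Analysis.ODE.hasDerivAt_tdFlow hX hsupp (by simp) t₀ x s
  have hud : ∀ s, HasDerivAt u (ℓ (X (s, γ s))) s := fun s =>
    ℓ.hasFDerivAt.comp_hasDerivAt s (hγd s)
  have hu0 : u t₀ = 0 := by simp [hu, hγ, hx]
  -- the key bound `|ℓ X(s, γ s)| ≤ K |u s|`
  set K : ℝ := ‖ℓ‖ * C * ‖ν‖ with hK
  have hbound : ∀ s, ‖ℓ (X (s, γ s))‖ ≤ K * ‖u s‖ := by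
    intro s
    have hfoot : ℓ (γ s - u s • ν) = 0 := by
      simp [hu, map_sub, map_smul, hℓν]
    have h0 : ℓ (X (s, γ s - u s • ν)) = 0 := htan s _ hfoot
    have h1 : ℓ (X (s, γ s)) = ℓ (X (s, γ s)) - ℓ (X (s, γ s - u s • ν)) := by rw [h0, sub_zero]
    rw [h1, ← map_sub]
    calc ‖ℓ (X (s, γ s) - X (s, γ s - u s • ν))‖
        ≤ ‖ℓ‖ * ‖X (s, γ s) - X (s, γ s - u s • ν)‖ := ℓ.le_opNorm _
      _ ≤ ‖ℓ‖ * (C * ‖u s • ν‖) := by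
          refine mul_le_mul_of_nonneg_left ?_ (norm_nonneg _)
          have h := hC.dist_le_mul (s, γ s) (s, γ s - u s • ν)
          rw [dist_eq_norm, dist_eq_norm] at h
          refine h.trans (le_of_eq ?_)
          congr 1
          simp [Prod.norm_def]
      _ = K * ‖u s‖ := by
          rw [norm_smul, hK]
          simp only [Real.norm_eq_abs]
          ring
  -- forward in time
  have hfwd : ∀ s, t₀ ≤ s → u s = 0 := by
    intro s hs
    have h := norm_le_gronwallBound_of_norm_deriv_right_le (f := u)
      (f' := fun s => ℓ (X (s, γ s))) (δ := 0) (K := K) (ε := 0) (a := t₀) (b := s)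
      (fun r _ => (hud r).continuousAt.continuousWithinAt)
      (fun r _ => (hud r).hasDerivWithinAt) (by simp [hu0])
      (fun r _ => by simpa using hbound r) s ⟨hs, le_rfl⟩
    rw [gronwallBound_ε0_δ0] at h
    exact norm_le_zero_iff.1 h
  -- backward in time: `w r = u (t₀ - r)`
  have hbwd : ∀ s, s ≤ t₀ → u s = 0 := by
    intro s hs
    set w : ℝ → ℝ := fun r => u (t₀ - r) with hw
    have hwd : ∀ r, HasDerivAt w (-ℓ (X (t₀ - r, γ (t₀ - r)))) r := by
      intro r
      have h1 : HasDerivAt (fun r : ℝ => t₀ - r) (-1) r := by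
        simpa using (hasDerivAt_id r).const_sub t₀
      have h2 : HasDerivAt (fun r => γ (t₀ - r)) ((-1 : ℝ) • X (t₀ - r, γ (t₀ - r))) r :=
        (hγd (t₀ - r)).scomp r h1
      have h3 := ℓ.hasFDerivAt.comp_hasDerivAt r h2
      refine h3.congr_deriv ?_
      simp
    have h := norm_le_gronwallBound_of_norm_deriv_right_le (f := w)
      (f' := fun r => -ℓ (X (t₀ - r, γ (t₀ - r)))) (δ := 0) (K := K) (ε := 0) (a := 0)
      (b := t₀ - s) (fun r _ => (hwd r).continuousAt.continuousWithinAt)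
      (fun r _ => (hwd r).hasDerivWithinAt) (by simp [hw, hu0])
      (fun r _ => by rw [norm_neg]; simpa [hw] using hbound (t₀ - r)) (t₀ - s)
      ⟨by linarith, le_rfl⟩
    rw [gronwallBound_ε0_δ0] at h
    have := norm_le_zero_iff.1 h
    simpa [hw] using this
  rcases le_total t₀ t with h | h
  · exact hfwd t h
  · exact hbwd t h

/-- **… and it preserves the open half-space `{ℓ > 0}`**: a trajectory from `{ℓ > 0}` reaching
`{ℓ ≤ 0}` would pass through the invariant hyperplane (intermediate value theorem).
[cite: HirschDT1976, Ch. 8 §1, Thm. 1.1] -/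
theorem apply_tdFlow_pos_of_tangent (htan : ∀ t y, ℓ y = 0 → ℓ (X (t, y)) = 0) {x : E}
    (hx : 0 < ℓ x) (t₀ t : ℝ) :
    0 < ℓ (Literature.Analysis.ODE.tdFlow hX hsupp (by simp) t₀ t x) := by
  by_contra hle
  push Not at hle
  set f : ℝ → ℝ := fun s => ℓ (Literature.Analysis.ODE.tdFlow hX hsupp (by simp) t₀ s x) with hf
  have hfc : Continuous f := by
    refine ℓ.continuous.comp ?_
    exact ((Literature.Analysis.ODE.contDiff_tdFlow hX hsupp (by simp)).continuous.comp
      (continuous_const.prodMk (continuous_id.prodMk continuous_const)))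
  have hft₀ : f t₀ = ℓ x := by simp [hf]
  have h0 : (0 : ℝ) ∈ uIcc (f t₀) (f t) := by
    rw [hft₀, mem_uIcc]
    exact Or.inr ⟨hle, hx.le⟩
  obtain ⟨s, -, hs⟩ := intermediate_value_uIcc hfc.continuousOn h0
  have hback := apply_tdFlow_eq_zero_of_tangent hX hsupp ℓ htan (x := _) hs s t₀
  rw [Literature.Analysis.ODE.tdFlow_tdFlow_symm] at hback
  exact hx.ne' hback

/-- **… and the open half-space `{ℓ < 0}`** (the previous statement for `-ℓ`).
[cite: HirschDT1976, Ch. 8 §1, Thm. 1.1] -/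
theorem apply_tdFlow_neg_of_tangent (htan : ∀ t y, ℓ y = 0 → ℓ (X (t, y)) = 0) {x : E}
    (hx : ℓ x < 0) (t₀ t : ℝ) :
    ℓ (Literature.Analysis.ODE.tdFlow hX hsupp (by simp) t₀ t x) < 0 := by
  have htan' : ∀ t y, (-ℓ) y = 0 → (-ℓ) (X (t, y)) = 0 := fun t y hy =>
    neg_eq_zero.2 (htan t y (neg_eq_zero.1 hy))
  have h := apply_tdFlow_pos_of_tangent hX hsupp (-ℓ) htan' (x := x) (by simpa using hx) t₀ t
  simpa using h

end HyperplaneInvariance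

/-! ### Linear algebra: the normal derivative is positive -/

section Normal

variable {E : Type u} [NormedAddCommGroup E] [NormedSpace ℝ E] [FiniteDimensional ℝ E]

/-- **If `D` preserves the hyperplane `{ℓ = 0}` and all the maps `id + t (D - id)`, `t ∈ [0, 1]`,
are injective, then the normal component `ℓ (D ν)` (`ℓ ν = 1`) is positive**: `id + t (D - id)`
induces on `E / {ℓ = 0} ≅ ℝ` the multiplication by `(1 - t) + t ℓ(D ν)`, which vanishes for some
`t ∈ (0, 1]` as soon as `ℓ (D ν) ≤ 0`. [folklore] -/
theorem pos_normal_of_slDeriv_injective {ℓ : E →L[ℝ] ℝ} {D : E →L[ℝ] E} {ν : E} (hν : ℓ ν = 1)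
    (hDK : ∀ v, ℓ v = 0 → ℓ (D v) = 0) (hinj : ∀ t ∈ Icc (0 : ℝ) 1, Injective (slDeriv t D)) :
    0 < ℓ (D ν) := by
  by_contra hd
  push Not at hd
  set d : ℝ := ℓ (D ν) with hdd
  -- the normal component of `D v` is `ℓ v · d`
  have hnormal : ∀ v, ℓ (D v) = ℓ v * d := by
    intro v
    have h0 : ℓ (v - ℓ v • ν) = 0 := by simp [hν]
    have h1 := hDK _ h0
    rw [map_sub, map_smul, map_sub, map_smul, smul_eq_mul] at h1
    linarith
  set t : ℝ := 1 / (1 - d) with ht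
  have h1d : 0 < 1 - d := by linarith
  have htI : t ∈ Icc (0 : ℝ) 1 := by
    refine ⟨by positivity, ?_⟩
    rw [ht, div_le_one h1d]
    linarith
  have hrange : ∀ v, ℓ (slDeriv t D v) = 0 := by
    intro v
    rw [slDeriv_apply, map_add, map_smul, map_sub, hnormal, smul_eq_mul]
    have : ℓ v + t * (ℓ v * d - ℓ v) = ℓ v * (1 - t * (1 - d)) := by ring
    rw [this, ht, div_mul_cancel₀ _ h1d.ne']
    ring
  have hsurj : Surjective (slDeriv t D) :=
    (LinearMap.injective_iff_surjective (f := (slDeriv t D).toLinearMap)).1 (hinj t htI)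
  obtain ⟨v, hv⟩ := hsurj ν
  have := hrange v
  rw [show slDeriv t D v = ν from hv, hν] at this
  exact one_ne_zero this

omit [FiniteDimensional ℝ E] in
/-- A derivative of a map preserving `W ∩ {ℓ = 0}` (`W` open) preserves `{ℓ = 0}`. [folklore] -/
theorem map_hyperplane_of_hasFDerivAt {ℓ : E →L[ℝ] ℝ} {W : Set E} (hW : IsOpen W) {P : E → E}
    (hPK : ∀ y ∈ W, ℓ y = 0 → ℓ (P y) = 0) {z : E} (hz : z ∈ W) (hzK : ℓ z = 0)
    {D : E →L[ℝ] E} (hD : HasFDerivAt P D z) (v : E) (hv : ℓ v = 0) : ℓ (D v) = 0 := by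
  -- differentiate `s ↦ ℓ (P (z + s v))`, which vanishes near `0`
  have hline : HasDerivAt (fun s : ℝ => z + s • v) v 0 := by
    simpa using ((hasDerivAt_id (0 : ℝ)).smul_const v).const_add z
  have hcomp : HasDerivAt (fun s : ℝ => ℓ (P (z + s • v))) (ℓ (D v)) 0 := by
    have h1 : HasFDerivAt P D (z + (0 : ℝ) • v) := by simpa using hD
    have h2 := h1.comp_hasDerivAt (0 : ℝ) hline
    exact ℓ.hasFDerivAt.comp_hasDerivAt (0 : ℝ) h2
  have hev : (fun s : ℝ => ℓ (P (z + s • v))) =ᶠ[𝓝 0] fun _ => 0 := by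
    have hc : ContinuousAt (fun s : ℝ => z + s • v) 0 := hline.continuousAt
    have hmem : ∀ᶠ s : ℝ in 𝓝 0, z + s • v ∈ W := by
      refine hc.preimage_mem_nhds ?_
      simpa using hW.mem_nhds hz
    filter_upwards [hmem] with s hs
    exact hPK _ hs (by simp [hzK, hv])
  have h0 : HasDerivAt (fun s : ℝ => ℓ (P (z + s • v))) 0 0 :=
    (hasDerivAt_const (0 : ℝ) (0 : ℝ)).congr_of_eventuallyEq hev
  exact hcomp.unique h0

end Normal

/-! ### The extension theorem relative to a hyperplane -/

section Extension

variable {E : Type u} [NormedAddCommGroup E] [NormedSpace ℝ E] [FiniteDimensional ℝ E]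

/-- The extension theorem relative to the hyperplane `{ℓ = 0}`, given a normal vector `ν` with
`ℓ ν = 1` (the case `ℓ ≠ 0` of `exists_ambientIsotopy_of_straightLine_halfSpace`).
[cite: HirschDT1976, Ch. 8 §1, Thm. 1.3] -/
theorem exists_ambientIsotopy_of_straightLine_halfSpace_aux {Z W : Set E}
    (hZ : IsCompact Z) (hW : IsOpen W) (hZW : Z ⊆ W) {P : E → E} (hP : ContDiffOn ℝ ∞ P W)
    (hPZ : ∀ z ∈ Z, P z = z) {D : E → E →L[ℝ] E} (hD : ∀ z ∈ Z, HasFDerivAt P (D z) z)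
    (hinj : ∀ z ∈ Z, ∀ t ∈ Icc (0 : ℝ) 1, Injective (slDeriv t (D z)))
    {W' : Set E} (hW' : IsOpen W') (hZW' : Z ⊆ W') {ℓ : E →L[ℝ] ℝ} {ν : E} (hν : ℓ ν = 1)
    (hPK : ∀ y ∈ W, ℓ y = 0 → ℓ (P y) = 0) :
    ∃ F : AmbientIsotopy 𝓘(ℝ, E) E, (∀ᶠ y in 𝓝ˢ Z, F.toFun 1 y = P y) ∧
      (∀ t y, y ∉ W' → F.toFun t y = y) ∧ (∃ R : ℝ, ∀ t (y : E), R ≤ ‖y‖ → F.toFun t y = y) ∧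
      (∀ t y, ℓ y = 0 → ℓ (F.toFun t y) = 0) ∧ (∀ t y, 0 < ℓ y → 0 < ℓ (F.toFun t y)) ∧
      (∀ t y, ℓ y < 0 → ℓ (F.toFun t y) < 0) := by
  have hPdiff : ∀ y ∈ W, HasFDerivAt P (fderiv ℝ P y) y := fun y hy =>
    ((hP.contDiffAt (hW.mem_nhds hy)).differentiableAt (by simp)).hasFDerivAt
  have hDeq : ∀ z ∈ Z, fderiv ℝ P z = D z := fun z hz => (hD z hz).fderiv
  have hfderiv_cont : ContinuousOn (fun y => fderiv ℝ P y) W :=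
    hP.continuousOn_fderiv_of_isOpen hW (by simp)
  -- Step 1: the set `S` of `(t, y)`, `y ∈ W`, where `id + t (DP(y) - id)` is invertible is open
  set A : ℝ × E → E →L[ℝ] E := fun q => slDeriv q.1 (fderiv ℝ P q.2) with hA
  have hAcont : ContinuousOn A ((univ : Set ℝ) ×ˢ W) := by
    have hf : ContinuousOn (fun q : ℝ × E => fderiv ℝ P q.2) ((univ : Set ℝ) ×ˢ W) :=
      hfderiv_cont.comp continuousOn_snd fun q hq => hq.2
    simp only [hA, slDeriv]
    exact continuousOn_const.add (continuousOn_fst.smul (hf.sub continuousOn_const))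
  set S : Set (ℝ × E) := ((univ : Set ℝ) ×ˢ W) ∩ A ⁻¹' {u | IsUnit u} with hS
  have hSopen : IsOpen S := hAcont.isOpen_inter_preimage (isOpen_univ.prod hW) Units.isOpen
  -- the equivalences `T q` and the derivative of the track on `S`
  have hequiv : ∀ q ∈ S, ∃ T : (ℝ × E) ≃L[ℝ] ℝ × E,
      HasFDerivAt (slTrack P) (T : ℝ × E →L[ℝ] ℝ × E) q := by
    rintro ⟨t, y⟩ ⟨⟨-, hyW⟩, hunit⟩
    have hunit' : IsUnit (slDeriv t (fderiv ℝ P y)) := hunit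
    set L : E ≃L[ℝ] E := ContinuousLinearEquiv.unitsEquiv ℝ E hunit'.unit with hL
    have hLcoe : (L : E →L[ℝ] E) = slDeriv t (fderiv ℝ P y) := by
      rw [hL]; ext η; simp
    refine ⟨slTrackEquiv L (P y - y), ?_⟩
    rw [coe_slTrackEquiv L hLcoe]
    exact hasFDerivAt_slTrack (hPdiff y hyW)
  have hKS : Icc (0 : ℝ) 1 ×ˢ Z ⊆ S := by
    rintro ⟨t, z⟩ ⟨ht, hz⟩
    refine ⟨⟨mem_univ _, hZW hz⟩, ?_⟩
    show IsUnit (slDeriv t (fderiv ℝ P z))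
    rw [hDeq z hz]
    obtain ⟨L, hL⟩ := exists_equiv_slDeriv (hinj z hz t ht)
    exact ⟨ContinuousLinearEquiv.toUnit L, by rw [← hL]; rfl⟩
  -- Step 2: injectivity of the track near `[0, 1] × Z`
  have hK : IsCompact (Icc (0 : ℝ) 1 ×ˢ Z) := isCompact_Icc.prod hZ
  have htrack_cont : ContinuousOn (slTrack P) ((univ : Set ℝ) ×ˢ W) :=
    (contDiffOn_slTrack hP).continuousOn
  have htrack_at : ∀ q ∈ S, ContDiffAt ℝ ∞ (slTrack P) q := fun q hq =>
    (contDiffOn_slTrack hP).contDiffAt ((isOpen_univ.prod hW).mem_nhds hq.1)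
  obtain ⟨V, hVopen, hKV, hVinj⟩ : ∃ V : Set (ℝ × E), IsOpen V ∧ Icc (0 : ℝ) 1 ×ˢ Z ⊆ V ∧
      InjOn (slTrack P) V := by
    refine exists_isOpen_injOn_of_isCompact hK (fun q hq => ?_) (fun q hq q' hq' h => ?_)
      (fun q hq => ?_)
    · exact (htrack_at q (hKS hq)).continuousAt
    · obtain ⟨t, z⟩ := q
      obtain ⟨t', z'⟩ := q'
      rw [slTrack_of_eq P (hPZ z hq.2), slTrack_of_eq P (hPZ z' hq'.2)] at h
      exact h
    · obtain ⟨T, hT⟩ := hequiv q (hKS hq)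
      have hstrict : HasStrictFDerivAt (slTrack P) (T : ℝ × E →L[ℝ] ℝ × E) q := by
        have h1 := (htrack_at q (hKS hq)).hasStrictFDerivAt (by simp)
        rwa [hT.fderiv] at h1
      exact ⟨_, (hstrict.toOpenPartialHomeomorph _).open_source.mem_nhds
        hstrict.mem_toOpenPartialHomeomorph_source,
        (hstrict.toOpenPartialHomeomorph _).injOn⟩
  -- the pairs `(t, y)` whose straight-line image `h_t(y)` lies in `W'`
  set G : Set (ℝ × E) :=
    ((univ : Set ℝ) ×ˢ W) ∩ (fun q : ℝ × E => slIsotopy P q.1 q.2) ⁻¹' W' with hG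
  have hsl_cont : ContinuousOn (fun q : ℝ × E => slIsotopy P q.1 q.2) ((univ : Set ℝ) ×ˢ W) :=
    htrack_cont.snd
  have hGopen : IsOpen G := hsl_cont.isOpen_inter_preimage (isOpen_univ.prod hW) hW'
  have hKG : Icc (0 : ℝ) 1 ×ˢ Z ⊆ G := by
    rintro ⟨t, z⟩ ⟨-, hz⟩
    refine ⟨⟨mem_univ _, hZW hz⟩, ?_⟩
    show slIsotopy P t z ∈ W'
    rw [slIsotopy_of_eq P (hPZ z hz)]
    exact hZW' hz
  -- **Step 2½ (new): the "good" pairs `(t, y)`, for which `ℓ (h_t y) = 0` forces `ℓ y = 0`.**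
  -- the normal derivative `Λ (t, y) = (1 - t) + t ℓ (DP(y) ν)` of `ℓ ∘ h_t` and where it is positive
  set Λ : ℝ × E → ℝ := fun q => (1 - q.1) + q.1 * ℓ (fderiv ℝ P q.2 ν) with hΛ
  have hΛcont : ContinuousOn Λ ((univ : Set ℝ) ×ˢ W) := by
    have hf : ContinuousOn (fun q : ℝ × E => fderiv ℝ P q.2) ((univ : Set ℝ) ×ˢ W) :=
      hfderiv_cont.comp continuousOn_snd fun q hq => hq.2
    have hf' : ContinuousOn (fun q : ℝ × E => ℓ (fderiv ℝ P q.2 ν)) ((univ : Set ℝ) ×ˢ W) :=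
      ℓ.continuous.comp_continuousOn (hf.clm_apply continuousOn_const)
    exact (continuousOn_const.sub continuousOn_fst).add (continuousOn_fst.mul hf')
  set Ωp : Set (ℝ × E) := ((univ : Set ℝ) ×ˢ W) ∩ Λ ⁻¹' Ioi 0 with hΩp
  have hΩpopen : IsOpen Ωp := hΛcont.isOpen_inter_preimage (isOpen_univ.prod hW) isOpen_Ioi
  -- the segment from the foot `π y = y - ℓ y • ν` to `y`: `r ↦ y - ((1 - r) ℓ y) • ν`
  set seg : (ℝ × E) × ℝ → ℝ × E := fun p => (p.1.1, p.1.2 - ((1 - p.2) * ℓ p.1.2) • ν) with hseg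
  have hseg_cont : Continuous seg := by
    refine (continuous_fst.comp continuous_fst).prodMk ?_
    exact (continuous_snd.comp continuous_fst).sub
      (((continuous_const.sub continuous_snd).mul
        (ℓ.continuous.comp (continuous_snd.comp continuous_fst))).smul continuous_const)
  set Cg : Set (ℝ × E) := {q | ∀ r ∈ Icc (0 : ℝ) 1, seg (q, r) ∈ Ωp} with hCg
  have hCgopen : IsOpen Cg := by
    rw [isOpen_iff_mem_nhds]
    intro q hq
    have h : ∀ r ∈ Icc (0 : ℝ) 1, ∀ᶠ p : (ℝ × E) × ℝ in 𝓝 (q, r), seg p ∈ Ωp := fun r hr =>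
      hseg_cont.continuousAt.preimage_mem_nhds (hΩpopen.mem_nhds (hq r hr))
    exact isCompact_Icc.eventually_forall_of_forall_eventually
      (P := fun (x : ℝ × E) (y : ℝ) => seg (x, y) ∈ Ωp) h
  set G₂ : Set (ℝ × E) :=
    (((univ : Set ℝ) ×ˢ W) ∩ {q | 0 < ℓ q.2 * ℓ (slIsotopy P q.1 q.2)}) ∪ Cg with hG₂
  have hG₂open : IsOpen G₂ := by
    refine IsOpen.union ?_ hCgopen
    have hc : ContinuousOn (fun q : ℝ × E => ℓ q.2 * ℓ (slIsotopy P q.1 q.2))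
        ((univ : Set ℝ) ×ˢ W) :=
      (ℓ.continuous.comp_continuousOn continuousOn_snd).mul (ℓ.continuous.comp_continuousOn hsl_cont)
    exact hc.isOpen_inter_preimage (isOpen_univ.prod hW) isOpen_Ioi
  have hKG₂ : Icc (0 : ℝ) 1 ×ˢ Z ⊆ G₂ := by
    rintro ⟨t, z⟩ ⟨ht, hz⟩
    dsimp only at ht hz
    by_cases hzK : ℓ z = 0
    · -- on the hyperplane: the degenerate segment `{z}`, where `Λ (t, z) > 0`
      refine Or.inr fun r hr => ?_
      have hsegz : seg ((t, z), r) = (t, z) := by simp [hseg, hzK]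
      rw [hsegz]
      refine ⟨⟨mem_univ _, hZW hz⟩, ?_⟩
      show 0 < (1 - t) + t * ℓ (fderiv ℝ P z ν)
      have hd : 0 < ℓ (fderiv ℝ P z ν) := by
        rw [hDeq z hz]
        exact pos_normal_of_slDeriv_injective hν
          (map_hyperplane_of_hasFDerivAt hW hPK (hZW hz) hzK (hD z hz)) (hinj z hz)
      rcases eq_or_lt_of_le ht.2 with h1 | h1
      · rw [h1]; simpa using hd
      · have : 0 ≤ t * ℓ (fderiv ℝ P z ν) := mul_nonneg ht.1 hd.le
        linarith
    · refine Or.inl ⟨⟨mem_univ _, hZW hz⟩, ?_⟩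
      show 0 < ℓ z * ℓ (slIsotopy P t z)
      rw [slIsotopy_of_eq P (hPZ z hz)]
      exact mul_self_pos.2 hzK
  -- goodness
  have hgood : ∀ q ∈ G₂, ℓ (slIsotopy P q.1 q.2) = 0 → ℓ q.2 = 0 := by
    rintro ⟨t, y⟩ hq h0
    rcases hq with ⟨-, hq⟩ | hq
    · exfalso
      have : 0 < ℓ y * ℓ (slIsotopy P t y) := hq
      rw [h0, mul_zero] at this
      exact lt_irrefl _ this
    · by_contra hy
      -- the function `φ r = ℓ (h_t (y - ((1 - r) ℓ y) • ν))` vanishes at `0` and `1`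
      set pt : ℝ → E := fun r => y - ((1 - r) * ℓ y) • ν with hpt
      set φ : ℝ → ℝ := fun r => ℓ (slIsotopy P t (pt r)) with hφ
      have hptW : ∀ r ∈ Icc (0 : ℝ) 1, pt r ∈ W := fun r hr => (hq r hr).1.2
      have hΛpos : ∀ r ∈ Icc (0 : ℝ) 1, 0 < Λ (t, pt r) := fun r hr => (hq r hr).2
      have hpt_d : ∀ r, HasDerivAt pt (ℓ y • ν) r := by
        intro r
        have h1 : HasDerivAt (fun r : ℝ => (1 - r) * ℓ y) (-(ℓ y)) r := by
          simpa using ((hasDerivAt_id r).const_sub 1).mul_const (ℓ y)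
        have h2 := (h1.smul_const ν).const_sub y
        simpa [hpt, neg_smul] using h2
      have hφ_d : ∀ r ∈ Icc (0 : ℝ) 1, HasDerivAt φ (ℓ y * Λ (t, pt r)) r := by
        intro r hr
        have h1 : HasFDerivAt (slIsotopy P t) (slDeriv t (fderiv ℝ P (pt r))) (pt r) :=
          hasFDerivAt_slIsotopy' t (hPdiff _ (hptW r hr))
        have h2 := h1.comp_hasDerivAt r (hpt_d r)
        have h3 := ℓ.hasFDerivAt.comp_hasDerivAt r h2
        refine h3.congr_deriv ?_
        simp only [hΛ, slDeriv_apply, map_smul, map_add, map_sub, hν,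
          smul_eq_mul]
        ring
      have hφ0 : φ 0 = 0 := by
        have hfoot : ℓ (pt 0) = 0 := by simp [hpt, hν]
        have hPfoot : ℓ (P (pt 0)) = 0 := hPK _ (hptW 0 (left_mem_Icc.2 zero_le_one)) hfoot
        simp only [hφ, slIsotopy, map_add, map_smul, map_sub, hfoot, hPfoot]
        simp
      have hφ1 : φ 1 = 0 := by
        have : pt 1 = y := by simp [hpt]
        simp only [hφ, this]
        exact h0
      obtain ⟨c, hc, hcd⟩ := exists_hasDerivAt_eq_slope φ (fun r => ℓ y * Λ (t, pt r))
        zero_lt_one (fun r hr => (hφ_d r hr).continuousAt.continuousWithinAt)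
        (fun r hr => hφ_d r (Ioo_subset_Icc_self hr))
      rw [hφ0, hφ1, sub_zero, sub_zero, div_one] at hcd
      have hpos := hΛpos c (Ioo_subset_Icc_self hc)
      rcases mul_eq_zero.1 hcd with h | h
      · exact hy h
      · exact hpos.ne' h
  -- Step 3: a product neighbourhood `J × U` of `[0, 1] × Z` inside `S ∩ V ∩ G ∩ G₂`
  obtain ⟨J₀, U₀, hJ₀, hU₀, hIJ₀, hZU₀, hJU₀⟩ :=
    generalized_tube_lemma isCompact_Icc hZ (((hSopen.inter hVopen).inter hGopen).inter hG₂open)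
      (subset_inter (subset_inter (subset_inter hKS hKV) hKG) hKG₂)
  obtain ⟨δ, hδ, hδJ⟩ := isCompact_Icc.exists_thickening_subset_open hJ₀ hIJ₀
  set J : Set ℝ := Ioo (-δ) (1 + δ) with hJ
  have hJsub : J ⊆ J₀ := by
    intro s hs
    apply hδJ
    rw [mem_thickening_iff]
    rcases le_or_gt s 0 with h0 | h0
    · refine ⟨0, left_mem_Icc.2 zero_le_one, ?_⟩
      rw [dist_comm, Real.dist_eq, zero_sub, abs_neg, abs_of_nonpos h0]
      linarith [hs.1]
    rcases le_or_gt s 1 with h1 | h1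
    · exact ⟨s, ⟨h0.le, h1⟩, by rw [dist_self]; exact hδ⟩
    · refine ⟨1, right_mem_Icc.2 zero_le_one, ?_⟩
      rw [Real.dist_eq, abs_of_pos (by linarith)]
      linarith [hs.2]
  obtain ⟨R₀, hR₀⟩ := hZ.isBounded.subset_ball 0
  set U : Set E := U₀ ∩ ball 0 R₀ with hU
  have hUopen : IsOpen U := hU₀.inter isOpen_ball
  have hZU : Z ⊆ U := subset_inter hZU₀ hR₀
  set O : Set (ℝ × E) := J ×ˢ U with hO
  have hOopen : IsOpen O := isOpen_Ioo.prod hUopen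
  have hOS : O ⊆ S := fun q hq => (hJU₀ ⟨hJsub hq.1, hq.2.1⟩).1.1.1
  have hOV : O ⊆ V := fun q hq => (hJU₀ ⟨hJsub hq.1, hq.2.1⟩).1.1.2
  have hOW' : ∀ q ∈ O, slIsotopy P q.1 q.2 ∈ W' := fun q hq => (hJU₀ ⟨hJsub hq.1, hq.2.1⟩).1.2.2
  have hOG₂ : O ⊆ G₂ := fun q hq => (hJU₀ ⟨hJsub hq.1, hq.2.1⟩).2
  have h0J : (0 : ℝ) ∈ J := ⟨by linarith, by linarith⟩
  have hUW : U ⊆ W := fun y hy => by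
    have : ((0 : ℝ), y) ∈ S := hOS ⟨h0J, hy⟩
    exact this.1.2
  -- Step 4: the track as a partial diffeomorphism `e : O ≅ Ω`
  have hOinj : InjOn (slTrack P) O := hVinj.mono hOV
  set e₀ : PartialEquiv (ℝ × E) (ℝ × E) := hOinj.toPartialEquiv (slTrack P) O with he₀
  have hopenmap : IsOpenMap (O.restrict (slTrack P)) := by
    rw [isOpenMap_iff_nhds_le]
    rintro ⟨q, hq⟩
    obtain ⟨T, hT⟩ := hequiv q (hOS hq)
    have hstrict : HasStrictFDerivAt (slTrack P) (T : ℝ × E →L[ℝ] ℝ × E) q := by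
      have h1 := (htrack_at q (hOS hq)).hasStrictFDerivAt (by simp)
      rwa [hT.fderiv] at h1
    have hmap : map (O.restrict (slTrack P)) (𝓝 ⟨q, hq⟩) = map (slTrack P) (𝓝 q) := by
      rw [restrict_eq, ← Filter.map_map, map_nhds_subtype_val, hOopen.nhdsWithin_eq hq]
    rw [hmap, hstrict.map_nhds_eq_of_equiv]
    exact le_rfl
  set e : OpenPartialHomeomorph (ℝ × E) (ℝ × E) :=
    OpenPartialHomeomorph.ofContinuousOpenRestrict e₀
      (htrack_cont.mono fun q hq => ⟨mem_univ _, hUW hq.2⟩) hopenmap hOopen with he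
  have hecoe : ⇑e = slTrack P := rfl
  have hesource : e.source = O := rfl
  have hesymm_smooth : ContDiffOn ℝ ∞ e.symm e.target := by
    intro b hb
    have hb' : e.symm b ∈ O := e.map_target hb
    obtain ⟨T, hT⟩ := hequiv _ (hOS hb')
    exact (e.contDiffAt_symm hb hT (htrack_at _ (hOS hb'))).contDiffWithinAt
  -- Step 5: the vector field on `Ω = e.target` and its cutoff
  set Ω : Set (ℝ × E) := e.target with hΩ
  have hΩopen : IsOpen Ω := e.open_target
  have hΩW' : ∀ b ∈ Ω, b.2 ∈ W' := fun b hb => by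
    have hb' : e.symm b ∈ O := e.map_target hb
    have hbe : b = slTrack P (e.symm b) := by rw [← hecoe]; exact (e.right_inv hb).symm
    rw [hbe]
    exact hOW' _ hb'
  set Y : ℝ × E → E := fun q => P (e.symm q).2 - (e.symm q).2 with hY
  have hYsmooth : ContDiffOn ℝ ∞ Y Ω := by
    have h2 : ContDiffOn ℝ ∞ (fun q => (e.symm q).2) Ω := hesymm_smooth.snd
    have hmaps : MapsTo (fun q => (e.symm q).2) Ω W := fun q hq => hUW (e.map_target hq).2
    exact (hP.comp h2 hmaps).sub h2
  -- **(new) `Y` is tangent to the hyperplane along the hyperplane**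
  have hYtan : ∀ b ∈ Ω, ℓ b.2 = 0 → ℓ (Y b) = 0 := by
    intro b hb hb0
    have hb' : e.symm b ∈ O := e.map_target hb
    have hbe : b = slTrack P (e.symm b) := by rw [← hecoe]; exact (e.right_inv hb).symm
    have hb2 : b.2 = slIsotopy P (e.symm b).1 (e.symm b).2 := by
      conv_lhs => rw [hbe]
      rfl
    have hy0 : ℓ (e.symm b).2 = 0 := hgood _ (hOG₂ hb') (by rw [← hb2]; exact hb0)
    have hPy0 : ℓ (P (e.symm b).2) = 0 := hPK _ (hUW hb'.2) hy0
    simp only [hY, map_sub, hy0, hPy0, sub_zero]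
  -- a compact neighbourhood `Zc` of `Z` in `U` and the compact set `C'` of the track
  obtain ⟨Zc, hZc, hZZc, hZcU⟩ := exists_compact_between hZ hUopen hZU
  set C' : Set (ℝ × E) := slTrack P '' (Icc (-(δ / 2)) (1 + δ / 2) ×ˢ Zc) with hC'
  have hIccJ : Icc (-(δ / 2)) (1 + δ / 2) ⊆ J := fun s hs =>
    ⟨by linarith [hs.1], by linarith [hs.2]⟩
  have hCO : Icc (-(δ / 2)) (1 + δ / 2) ×ˢ Zc ⊆ O := prod_mono hIccJ hZcU
  have hC'cpt : IsCompact C' := (isCompact_Icc.prod hZc).image_of_continuousOn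
    ((htrack_cont.mono fun q hq => ⟨mem_univ _, hUW hq.2⟩).mono hCO)
  have hC'Ω : C' ⊆ Ω := by
    rintro _ ⟨q, hq, rfl⟩
    exact e.map_source (show q ∈ e.source from hCO hq)
  obtain ⟨t₁, ht₁, hC't₁, ht₁Ω⟩ := exists_compact_between hC'cpt hΩopen hC'Ω
  obtain ⟨ρ, hρ1, hρ0, hρ01⟩ := exists_contMDiffMap_one_nhds_of_subset_interior 𝓘(ℝ, ℝ × E)
    hC'cpt.isClosed hC't₁ (n := (⊤ : ℕ∞))
  have hρsmooth : ContDiff ℝ ∞ (ρ : ℝ × E → ℝ) := contMDiff_iff_contDiff.1 ρ.contMDiff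
  set X : ℝ × E → E := fun q => (ρ q) • Y q with hX
  have hXsmooth : ContDiff ℝ ∞ X := by
    refine contDiff_iff_contDiffAt.2 fun q => ?_
    by_cases hq : q ∈ Ω
    · exact (hρsmooth.contDiffAt).smul (hYsmooth.contDiffAt (hΩopen.mem_nhds hq))
    · have hq' : q ∉ t₁ := fun h => hq (ht₁Ω h)
      have hev : X =ᶠ[𝓝 q] fun _ => 0 := by
        filter_upwards [ht₁.isClosed.isOpen_compl.mem_nhds hq'] with q' hq''
        simp only [hX, hρ0 q' hq'', zero_smul]
      exact contDiffAt_const.congr_of_eventuallyEq hev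
  have hXsupp : HasCompactSupport X := by
    refine HasCompactSupport.of_support_subset_isCompact ht₁ fun q hq => ?_
    by_contra hq'
    exact hq (by simp only [hX, hρ0 q hq', zero_smul])
  -- **(new) `X` is tangent to the hyperplane along the hyperplane**
  have hXtan : ∀ t y, ℓ y = 0 → ℓ (X (t, y)) = 0 := by
    intro t y hy
    by_cases hq : ((t, y) : ℝ × E) ∈ Ω
    · simp only [hX, map_smul, hYtan _ hq hy, smul_zero]
    · have hq' : ((t, y) : ℝ × E) ∉ t₁ := fun h => hq (ht₁Ω h)
      simp only [hX, hρ0 _ hq', zero_smul, map_zero]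
  -- Step 6: the flow, as an ambient isotopy
  set F := AmbientIsotopy.ofField hXsmooth hXsupp with hF
  have hFt : ∀ t y, F.toFun t y = Literature.Analysis.ODE.tdFlow hXsmooth hXsupp (by simp) 0 t y :=
    fun t y => rfl
  refine ⟨F, ?_, ?_, ?_, ?_, ?_, ?_⟩
  · -- agreement with `P` on `interior Zc` at time `1`
    have hagree : ∀ p ∈ interior Zc, F.toFun 1 p = P p := by
      intro p hp
      have hpZc : p ∈ Zc := interior_subset hp
      have hcurve : ∀ s ∈ Ioo (-(δ / 2)) (1 + δ / 2),
          HasDerivAt (fun s => slIsotopy P s p) (X (s, slIsotopy P s p)) s := by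
        intro s hs
        have hsO : (s, p) ∈ O := hCO ⟨Ioo_subset_Icc_self hs, hpZc⟩
        have hval : X (s, slIsotopy P s p) = P p - p := by
          have hmemC' : (s, slIsotopy P s p) ∈ C' :=
            ⟨(s, p), ⟨Ioo_subset_Icc_self hs, hpZc⟩, rfl⟩
          have hρq : ρ (s, slIsotopy P s p) = 1 := hρ1.self_of_nhdsSet _ hmemC'
          have hsymm : e.symm (s, slIsotopy P s p) = (s, p) := by
            have := e.left_inv (show (s, p) ∈ e.source from hsO)
            simpa [hecoe] using this
          simp only [hX, hY, hρq, one_smul, hsymm]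
        rw [hval]
        have h1 : HasDerivAt (fun s : ℝ => s • (P p - p)) ((1 : ℝ) • (P p - p)) s :=
          (hasDerivAt_id s).smul_const _
        rw [one_smul] at h1
        have h2 := h1.const_add p
        exact h2
      have key := Literature.Analysis.ODE.tdFlow_eq_of_hasDerivAt hXsmooth hXsupp (by simp)
        (γ := fun s => slIsotopy P s p) (a := -(δ / 2)) (b := 1 + δ / 2) (t₀ := 0)
        ⟨by linarith, by linarith⟩ hcurve (t := 1) ⟨by linarith, by linarith⟩
      simp only [slIsotopy_zero, slIsotopy_one] at key
      rw [hFt]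
      exact key
    exact Filter.eventually_of_mem (isOpen_interior.mem_nhdsSet.2 hZZc) hagree
  · -- `F t = id` off `W'`: the field vanishes identically on `ℝ × (E ∖ W')`
    intro t y hy
    rw [hFt]
    refine Literature.Analysis.ODE.tdFlow_eq_self_of_forall_eq_zero hXsmooth hXsupp (by simp)
      (fun s => ?_) 0 t
    have hq' : ((s, y) : ℝ × E) ∉ t₁ := fun h => hy (hΩW' _ (ht₁Ω h))
    simp only [hX, hρ0 _ hq', zero_smul]
  · obtain ⟨R, hR⟩ :=
      Literature.Analysis.ODE.exists_forall_le_norm_tdFlow_eq_self hXsmooth hXsupp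
        (by simp : (1 : ℕ∞) ≤ ⊤)
    exact ⟨R, fun t y hy => by rw [hFt]; exact hR y hy 0 t⟩
  · intro t y hy
    rw [hFt]
    exact apply_tdFlow_eq_zero_of_tangent hXsmooth hXsupp ℓ hXtan hy 0 t
  · intro t y hy
    rw [hFt]
    exact apply_tdFlow_pos_of_tangent hXsmooth hXsupp ℓ hXtan hy 0 t
  · intro t y hy
    rw [hFt]
    exact apply_tdFlow_neg_of_tangent hXsmooth hXsupp ℓ hXtan hy 0 t

/-- **Isotopy extension for straight-line isotopies, relative to a hyperplane and its
half-spaces** (Hirsch, *Differential Topology* (1976), Ch. 8 §1, Thms. 1.3–1.4; Kosinski (1993),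
II (5.2), III §4, VI §5).  Let `Z` be a compact subset of a finite-dimensional real normed space
`E`, `P` a `C^∞` map on an open `W ⊇ Z` with `P z = z` on `Z`, with derivative `D z` at the points
of `Z`, such that `id + t (D z - id)` is injective for all `z ∈ Z`, `t ∈ [0, 1]`; let `W'` be any
open set containing `Z`, and let `ℓ : E →L[ℝ] ℝ` be a linear form such that **`P` maps
`W ∩ {ℓ = 0}` into `{ℓ = 0}`**.  Then there is an ambient isotopy `F` of `E` (a compactly
supported diffeotopy) with `F₁ = P` on a neighbourhood of `Z`, all stages the identity off `W'`
and off one ball, and **every stage preserving the hyperplane `{ℓ = 0}` and the open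
half-spaces `{ℓ > 0}`, `{ℓ < 0}`**; in particular every stage restricts to a self-map of the
closed half-space `{ℓ ≥ 0}`. [cite: HirschDT1976, Ch. 8 §1, Thm. 1.3]
[cite: Kosinski1993, II (5.2)] -/
theorem exists_ambientIsotopy_of_straightLine_halfSpace {Z W : Set E}
    (hZ : IsCompact Z) (hW : IsOpen W) (hZW : Z ⊆ W) {P : E → E} (hP : ContDiffOn ℝ ∞ P W)
    (hPZ : ∀ z ∈ Z, P z = z) {D : E → E →L[ℝ] E} (hD : ∀ z ∈ Z, HasFDerivAt P (D z) z)
    (hinj : ∀ z ∈ Z, ∀ t ∈ Icc (0 : ℝ) 1, Injective (slDeriv t (D z)))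
    {W' : Set E} (hW' : IsOpen W') (hZW' : Z ⊆ W') (ℓ : E →L[ℝ] ℝ)
    (hPK : ∀ y ∈ W, ℓ y = 0 → ℓ (P y) = 0) :
    ∃ F : AmbientIsotopy 𝓘(ℝ, E) E, (∀ᶠ y in 𝓝ˢ Z, F.toFun 1 y = P y) ∧
      (∀ t y, y ∉ W' → F.toFun t y = y) ∧ (∃ R : ℝ, ∀ t (y : E), R ≤ ‖y‖ → F.toFun t y = y) ∧
      (∀ t y, ℓ y = 0 → ℓ (F.toFun t y) = 0) ∧ (∀ t y, 0 < ℓ y → 0 < ℓ (F.toFun t y)) ∧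
      (∀ t y, ℓ y < 0 → ℓ (F.toFun t y) < 0) := by
  by_cases hℓ : ℓ = 0
  · obtain ⟨F, h1, h2, h3⟩ :=
      exists_ambientIsotopy_of_straightLine_of_subset hZ hW hZW hP hPZ hD hinj hW' hZW'
    exact ⟨F, h1, h2, h3, by simp [hℓ], by simp [hℓ], by simp [hℓ]⟩
  · obtain ⟨v, hv⟩ : ∃ v : E, ℓ v ≠ 0 := by
      by_contra h
      push Not at h
      exact hℓ (ContinuousLinearMap.ext fun v => by simpa using h v)
    have hν : ℓ ((ℓ v)⁻¹ • v) = 1 := by rw [map_smul, smul_eq_mul, inv_mul_cancel₀ hv]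
    exact exists_ambientIsotopy_of_straightLine_halfSpace_aux hZ hW hZW hP hPZ hD hinj hW' hZW'
      hν hPK

/-- **The time-one diffeomorphism, with the closed half-space `{ℓ ≥ 0}` and the hyperplane
`{ℓ = 0}` invariant in both directions** — the form consumed by restriction to a manifold with
boundary (e.g. `Diffeomorph.closedBallRestrict` after an inversion taking the half-space to the
ball). [cite: HirschDT1976, Ch. 8 §1, Thm. 1.3] -/
theorem exists_diffeomorph_of_straightLine_halfSpace {Z W : Set E}
    (hZ : IsCompact Z) (hW : IsOpen W) (hZW : Z ⊆ W) {P : E → E} (hP : ContDiffOn ℝ ∞ P W)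
    (hPZ : ∀ z ∈ Z, P z = z) {D : E → E →L[ℝ] E} (hD : ∀ z ∈ Z, HasFDerivAt P (D z) z)
    (hinj : ∀ z ∈ Z, ∀ t ∈ Icc (0 : ℝ) 1, Injective (slDeriv t (D z)))
    {W' : Set E} (hW' : IsOpen W') (hZW' : Z ⊆ W') (ℓ : E →L[ℝ] ℝ)
    (hPK : ∀ y ∈ W, ℓ y = 0 → ℓ (P y) = 0) :
    ∃ Φ : E ≃ₘ⟮𝓘(ℝ, E), 𝓘(ℝ, E)⟯ E, (∀ᶠ y in 𝓝ˢ Z, Φ y = P y) ∧ (∀ y, y ∉ W' → Φ y = y) ∧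
      (∀ y, 0 ≤ ℓ y ↔ 0 ≤ ℓ (Φ y)) ∧ (∀ y, ℓ y = 0 ↔ ℓ (Φ y) = 0) := by
  obtain ⟨F, h1, h2, -, h4, h5, h6⟩ :=
    exists_ambientIsotopy_of_straightLine_halfSpace hZ hW hZW hP hPZ hD hinj hW' hZW' ℓ hPK
  refine ⟨F.toDiffeomorph 1, ?_, fun y hy => ?_, fun y => ?_, fun y => ?_⟩
  · filter_upwards [h1] with y hy
    rw [← hy]
    rfl
  · exact h2 1 y hy
  · show 0 ≤ ℓ y ↔ 0 ≤ ℓ (F.toFun 1 y)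
    constructor
    · intro hy
      rcases hy.lt_or_eq with h | h
      · exact (h5 1 y h).le
      · exact (h4 1 y h.symm).ge
    · intro hy
      by_contra h
      push Not at h
      exact (h6 1 y h).not_ge hy
  · show ℓ y = 0 ↔ ℓ (F.toFun 1 y) = 0
    constructor
    · exact h4 1 y
    · intro hy
      rcases lt_trichotomy (ℓ y) 0 with h | h | h
      · exact absurd hy (h6 1 y h).ne
      · exact h
      · exact absurd hy (h5 1 y h).ne'

end Extension

end Literature.Topology.FourManifolds

end
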